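import Mathlib

/-!
# Finite-order twists do not change the infinity type (T3.3 / T3.5)

Blind re-derivation cell `pub-hodge-repro`, Tier 3, seat `t3-p2` (prover-pub-hodge-repro-t3-p2-g12-0), sub-goal T3.3 of
`route/TIER3.md` (§7, the dictionary of §4.1: «finite-order twists change neither `Φ` nor the reflex ⇒
`A_{μν} ∼ A_{T_i}^m` for every finite-order `ν`», and T3.2 (b) «each `μ_i` may be replaced by `μ_i ν_i`, `ν_i` a
finite-order anticyclotomic character», `proofs/t3-p2/R3R4-INSTANTIATION.md` §4.1 / §4.4bis).  Target tree path
`lean/Summits/Ventures/HodgeRepro/Tier3FiniteOrderTwist.lean`; `import Mathlib` only.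

The elementary core, on the kernel.  The infinity type of a Hecke character `μ` of a CM field `M` is its restriction
to the archimedean torus `M_∞^× ≅ (ℂ^×)^n` (DR 2015 Lemma 3.5: `λ_∞(z) = ∏_{v ∈ Φ} z̄_v / |z_v|`), and the CM type `Φ`
is read off from that restriction (the dictionary; kernel twin `T3TypeNorm` for the determinant clause).  So the
sentence reduces to: **a character of finite order on `(ℂ^×)^n` is trivial**, because every element of `ℂ^×` is an
`n`-th power (`ℂ` is algebraically closed) — a finite-order character of any group in which `x ↦ xⁿ` is onto is
trivial.

* `eq_one_of_pow_eq_one_of_surjective_pow` — if `w ↦ wⁿ` is onto `G` and `χ ^ n = 1` then `χ = 1`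
  (`χ(wⁿ) = χ(w)ⁿ = 1`); `eq_one_of_pow_eq_one` — the same with Mathlib's `RootableBy G ℕ`;
  `eq_one_of_isOfFinOrder` — the `IsOfFinOrder` form;
* `units_exists_pow_eq`, `surjective_pow_units` — every unit of `ℂ` is an `n`-th power of a unit
  (`IsAlgClosed.exists_pow_nat_eq`); `eq_one_of_pow_eq_one_units` — a finite-order character of `ℂˣ` is trivial;
* `surjective_pow_torus`, `eq_one_of_pow_eq_one_torus`, `eq_one_of_isOfFinOrder_torus` — the same on the torus
  `ι → ℂˣ` (`M_∞^×` for `ι` = the complex places of `M`);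
* `comp_mul_eq_of_pow_comp_eq_one`, `comp_mul_eq_of_pow_eq_one`, `comp_mul_eq_of_isOfFinOrder` — **the sentence**:
  for any group `G` (the idele class group of `M`) with an archimedean inclusion `incl : (ι → ℂˣ) →* G`, the
  infinity type `(μ ν).comp incl` of a twist by a finite-order `ν` equals the infinity type `μ.comp incl` of `μ`;
* `comp_eq_iff_div_comp_eq_one`, `comp_div_eq_one_of_isOfFinOrder` — two characters have the same infinity type
  iff their quotient has trivial infinity type (the converse direction — trivial infinity type + a profinite
  domain ⇒ finite order — is `Tier3ProfiniteCharacter.exists_pow_eq_one`).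

Nothing here says anything about the status of the Hodge conjecture for CM abelian varieties, which is NOT proved.
-/

set_option autoImplicit false

namespace HodgeRepro

namespace T3.FiniteOrderTwist

section Abstract

variable {G M : Type*} [Group G] [CommMonoid M]

/-- If every element of `G` is an `n`-th power and `χ ^ n = 1`, then `χ = 1`: for `z = wⁿ`,
`χ z = χ (wⁿ) = (χ w)ⁿ = (χ ^ n) w = 1`. -/
theorem eq_one_of_pow_eq_one_of_surjective_pow {n : ℕ}
    (hroot : Function.Surjective (fun w : G => w ^ n)) (χ : G →* M) (hχ : χ ^ n = 1) : χ = 1 := by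
  ext z
  obtain ⟨w, rfl⟩ := hroot z
  have h := congrArg (fun f : G →* M => f w) hχ
  simpa [MonoidHom.pow_apply, map_pow] using h

/-- The same for a group that is `ℕ`-rootable in Mathlib's sense (`RootableBy G ℕ`): a character of finite order
`n ≠ 0` is trivial. -/
theorem eq_one_of_pow_eq_one [RootableBy G ℕ] {n : ℕ} (hn : n ≠ 0) (χ : G →* M)
    (hχ : χ ^ n = 1) : χ = 1 :=
  eq_one_of_pow_eq_one_of_surjective_pow (RootableBy.surjective_pow G ℕ hn) χ hχ

/-- `IsOfFinOrder` form (the target a commutative group, so that `G →* M` is a group): a character of finite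
order on an `ℕ`-rootable group is trivial. -/
theorem eq_one_of_isOfFinOrder {M : Type*} [CommGroup M] [RootableBy G ℕ] (χ : G →* M)
    (hχ : IsOfFinOrder χ) : χ = 1 := by
  obtain ⟨n, hn, h⟩ := isOfFinOrder_iff_pow_eq_one.mp hχ
  exact eq_one_of_pow_eq_one hn.ne' χ h

end Abstract

section Complex

/-- Every unit of `ℂ` is an `n`-th power of a unit, `n ≠ 0` (`ℂ` is algebraically closed:
`IsAlgClosed.exists_pow_nat_eq`; the root is non-zero since its power is). -/
theorem units_exists_pow_eq {n : ℕ} (hn : n ≠ 0) (z : ℂˣ) : ∃ w : ℂˣ, w ^ n = z := by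
  obtain ⟨w, hw⟩ := IsAlgClosed.exists_pow_nat_eq (z : ℂ) (Nat.pos_of_ne_zero hn)
  have hw0 : w ≠ 0 := by
    rintro rfl
    rw [zero_pow hn] at hw
    exact z.ne_zero hw.symm
  refine ⟨Units.mk0 w hw0, ?_⟩
  ext
  simp [hw]

/-- `w ↦ wⁿ` is onto `ℂˣ` for `n ≠ 0`. -/
theorem surjective_pow_units {n : ℕ} (hn : n ≠ 0) : Function.Surjective (fun w : ℂˣ => w ^ n) :=
  fun z => units_exists_pow_eq hn z

/-- A character of finite order on `ℂˣ` is trivial. -/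
theorem eq_one_of_pow_eq_one_units {M : Type*} [CommMonoid M] {n : ℕ} (hn : n ≠ 0) (χ : ℂˣ →* M)
    (hχ : χ ^ n = 1) : χ = 1 :=
  eq_one_of_pow_eq_one_of_surjective_pow (surjective_pow_units hn) χ hχ

/-- `w ↦ wⁿ` is onto the torus `ι → ℂˣ` for `n ≠ 0` (coordinatewise roots). -/
theorem surjective_pow_torus {ι : Type*} {n : ℕ} (hn : n ≠ 0) :
    Function.Surjective (fun w : ι → ℂˣ => w ^ n) := by
  intro z
  choose w hw using fun i => units_exists_pow_eq hn (z i)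
  exact ⟨w, funext fun i => (Pi.pow_apply w n i).trans (hw i)⟩

/-- **A character of finite order on the torus `(ℂ^×)^ι` is trivial.** -/
theorem eq_one_of_pow_eq_one_torus {ι M : Type*} [CommMonoid M] {n : ℕ} (hn : n ≠ 0)
    (χ : (ι → ℂˣ) →* M) (hχ : χ ^ n = 1) : χ = 1 :=
  eq_one_of_pow_eq_one_of_surjective_pow (surjective_pow_torus hn) χ hχ

/-- `IsOfFinOrder` form on the torus. -/
theorem eq_one_of_isOfFinOrder_torus {ι M : Type*} [CommGroup M] (χ : (ι → ℂˣ) →* M)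
    (hχ : IsOfFinOrder χ) : χ = 1 := by
  obtain ⟨n, hn, h⟩ := isOfFinOrder_iff_pow_eq_one.mp hχ
  exact eq_one_of_pow_eq_one_torus hn.ne' χ h

end Complex

section InfinityType

variable {G M ι : Type*} [Group G] [CommMonoid M]

/-- **Finite-order twists do not change the infinity type** (restriction-form hypothesis): if the archimedean
restriction `ν.comp incl` of the twist `ν` has finite order `n ≠ 0`, then `μ ν` and `μ` have the same archimedean
restriction. -/
theorem comp_mul_eq_of_pow_comp_eq_one (incl : (ι → ℂˣ) →* G) (μ ν : G →* M) {n : ℕ} (hn : n ≠ 0)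
    (hν : (ν.comp incl) ^ n = 1) : (μ * ν).comp incl = μ.comp incl := by
  rw [MonoidHom.mul_comp, eq_one_of_pow_eq_one_torus hn _ hν, mul_one]

/-- A character of finite order restricts to a character of finite order. -/
theorem comp_pow_eq_one_of_pow_eq_one (incl : (ι → ℂˣ) →* G) (ν : G →* M) {n : ℕ} (hν : ν ^ n = 1) :
    (ν.comp incl) ^ n = 1 := by
  ext z
  have h := congrArg (fun f : G →* M => f (incl z)) hν
  simpa [MonoidHom.pow_apply] using h

/-- **Finite-order twists do not change the infinity type**: for `ν ^ n = 1`, `n ≠ 0`,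
`(μ ν).comp incl = μ.comp incl`. -/
theorem comp_mul_eq_of_pow_eq_one (incl : (ι → ℂˣ) →* G) (μ ν : G →* M) {n : ℕ} (hn : n ≠ 0)
    (hν : ν ^ n = 1) : (μ * ν).comp incl = μ.comp incl :=
  comp_mul_eq_of_pow_comp_eq_one incl μ ν hn (comp_pow_eq_one_of_pow_eq_one incl ν hν)

/-- The `IsOfFinOrder` form: a twist by a character of finite order has the same infinity type. -/
theorem comp_mul_eq_of_isOfFinOrder {M : Type*} [CommGroup M] (incl : (ι → ℂˣ) →* G) (μ ν : G →* M)
    (hν : IsOfFinOrder ν) : (μ * ν).comp incl = μ.comp incl := by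
  obtain ⟨n, hn, h⟩ := isOfFinOrder_iff_pow_eq_one.mp hν
  exact comp_mul_eq_of_pow_eq_one incl μ ν hn.ne' h

/-- Two characters have the same infinity type iff their quotient has trivial infinity type. -/
theorem comp_eq_iff_div_comp_eq_one {M : Type*} [CommGroup M] (incl : (ι → ℂˣ) →* G) (μ μ' : G →* M) :
    μ'.comp incl = μ.comp incl ↔ (μ' / μ).comp incl = 1 := by
  rw [MonoidHom.div_comp, div_eq_one]

/-- A twist by a character of finite order has a quotient of trivial infinity type (the converse of
`Tier3ProfiniteCharacter.exists_pow_eq_one` — there trivial infinity type on a profinite domain gives finite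
order). -/
theorem comp_div_eq_one_of_isOfFinOrder {M : Type*} [CommGroup M] (incl : (ι → ℂˣ) →* G) (μ ν : G →* M)
    (hν : IsOfFinOrder ν) : ((μ * ν) / μ).comp incl = 1 :=
  (comp_eq_iff_div_comp_eq_one incl μ (μ * ν)).mp (comp_mul_eq_of_isOfFinOrder incl μ ν hν)

end InfinityType

end T3.FiniteOrderTwist

end HodgeRepro
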